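/-
Copyright (c) 2026 the pub-hodgecm-mathlib formalisation cell (harness21).  Prover seat hodgecm-mathlib-K2E1b-p15 (g0) on loan to engine E3, Track B ∕ K2-LIT
(build stream 29), h413 = `stmt-HodgeConjecture-24833`, line `K2_E3_EllipticInputs`, unit U12 «Characters» (Harish-Chandra local boundedness), sub-skeleton
U12d (K2E3-p12): the CENTRAL REDUCTION of the socket's unit relation.  2026-09-03.
-/
import Mathlib.RingTheory.Polynomial.Resultant.Basic     -- `Polynomial.discr`, `resultant_deriv`, `resultant_scaleRoots`, `resultant_add_right_deg`
import Mathlib.RingTheory.Polynomial.ScaleRoots          -- `Polynomial.scaleRoots`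
import Mathlib.LinearAlgebra.Matrix.Charpoly.Disc        -- `Matrix.discr`, `Matrix.charpoly_natDegree_eq_dim`, `Matrix.charpoly_monic`
import HarnessLib

/-!
# h413 ∕ Track B «K2-LIT», line `K2_E3_EllipticInputs`, U12d: HOMOGENEITY OF THE DISCRIMINANT OF THE CHARACTERISTIC POLYNOMIAL (any size, any commutative
# ring) and the invariance of the unit relation `u·det(g)^{N−1} = disc(χ_g)` under central (scalar unit) translation `g ↦ ζ g`

Cell `pub/hodgecm-mathlib`, crux H413 = `stmt-HodgeConjecture-24833`, route of record `HCCMUnconditional`; chair K2-lead (g0); dealt BY NAME by K2E3-p12 (g0) for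
the E3 dealer K2E3-plan (g1), DEALS BATCH #2, 2026-09-03T22:16:32Z («SMALLER ALTERNATIVE `Theorems/K2E3UnitRelScalarMul.lean` — the socket's unit relation is
invariant under central∕scalar translation … via `disc(χ_{z•A}) = z^{N(N−1)}·disc(χ_A)` (general `N`; ★ only `N = 3` `discr_smul_fin_three`) — the central reduction
«socket at `ζ·s` ⟸ socket at `s`»»).  THEOREMS ONLY (no `def`, no `instance`, no `notation`, no named-fact hypothesis, no `sorry`); imports = Mathlib + HarnessLib;
lane `--supports stmt-HodgeConjecture-24833 --as helper` (count-neutral).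

WHERE IT IS USED.  The U12 sockets of `Cruxes/H413/Lines/K2_E3_EllipticInputsSigs_U12Characters.lean` (`sig_K2E3NormalizedCharBddNearSemisimple` and its U12d
sub-sockets (S-abc)∕(S-d), HOME `K2/K2E3-p12/g0/SUBSIGS-U12d-CayleySlice.v1.K2E3-p12-g0.lean`) weigh `|Θ(y)|` by `|u|^{1∕4}` for the units `u` with
`u · det(y)^{N−1} = disc(χ_y)` (`(… y …).charpoly.discr`, Mathlib's Sylvester discriminant) — Harish-Chandra's `|D_G(y)|^{1∕2}` in the unit-relation currency of the
line.  At a CENTRAL point `ζ·s` (`ζ` a scalar unit of `R = L ⊗ L⁺_v`) the relation for `ζ·y` is the relation for `y` (this file's head `unitRel_units_smul_iff`):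
both sides scale by the unit `ζ^{N(N−1)}` — so the socket at `ζ·s` reduces to the socket at `s` [HarishChandra1999 §18 p. 79: the descent `γ ↦ γ·c(Y)` is taken
modulo the centre].

THE MATHEMATICS (strategy: Mathlib's resultant calculus over an ARBITRARY commutative ring — no splitting field, no domain hypothesis, no universal-polynomial
detour).  For `f` monic of degree `n` and `r ∈ R`:
* `derivative (f.scaleRoots r) = C r^{n−1−d} · (f′).scaleRoots r`, `d = natDegree f′` (coefficientwise; the correction `r^{n−1−d}` absorbs a drop of degree of
  `f′` in positive characteristic) — `derivative_scaleRoots`;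
* `Res_{n,n−1}(F, F′) = r^{n(n−1)} · Res_{n,n−1}(f, f′)` for `F = f.scaleRoots r`, from Mathlib's `resultant_scaleRoots` (`Res(f∘r, g∘r) = r^{deg f · deg g} Res(f,g)`),
  `resultant_C_mul_right` and the degree padding `resultant_add_right_deg` (monic: the padding factor is `1`);
* `disc(F) = r^{n(n−1)} · disc(f)` by `resultant_deriv` (`Res_{n,n−1}(f, f′) = ± lc(f) · disc f`, `lc = 1`) — **`discr_scaleRoots_of_monic`**;
* `χ_{zA} = χ_A.scaleRoots z` for a UNIT `z` (substitute `X ↦ zX`, injective for a unit: `χ_{zA}(zX) = det(zX − zA) = z^N χ_A(X) = (χ_A.scaleRoots z)(zX)`) —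
  `charpoly_units_smul` (the field case is ★ `Literature.NumberTheory.GaloisRepresentations.charpoly_smul_of_ne_zero`);
* hence **`discr_charpoly_units_smul`**: `disc(χ_{zA}) = z^{N(N−1)} · disc(χ_A)` (★ `Literature.LinearAlgebra.Matrix.discr_smul_fin_three` is `N = 3`, any `z`),
  and with `det(zA) = z^N det A` the head **`unitRel_units_smul_iff`**: `u·det(zA)^{N−1} = disc(χ_{zA}) ↔ u·det(A)^{N−1} = disc(χ_A)`.

* §1 `scaleRoots_comp_C_mul_X`, `comp_C_mul_X_injective_of_units` · substitution `X ↦ zX` (commutative-ring forms of two ★ field lemmas);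
* §1 `derivative_scaleRoots`, **`discr_scaleRoots_of_monic`**                 · the discriminant of a monic is homogeneous of weight `n(n−1)` under root scaling;
* §2 `charpoly_units_smul`, **`discr_charpoly_units_smul`**, `matrixDiscr_units_smul` · `χ_{zA}`, `disc(χ_{zA})`, `Matrix.discr (z • A)`;
* §3 **`unitRel_units_smul_iff`** (any index type) and **`unitRel_units_smul_iff_fin`** (`Fin N`, exponent `N − 1` as in the sockets).

HONEST LABEL.  HC_CM is proved only modulo the 7 printed citations (2 remaining named inputs: hLiu418 = `stmt-HodgeConjecture-24832`, h413 =
`stmt-HodgeConjecture-24833`) until rung 0 closes; this file moves no counter.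

## References
* [HarishChandra1999AdmissibleDistributions] Harish-Chandra, *Admissible invariant distributions on reductive p-adic groups* (notes by S. DeBacker, M. Vignéras),
  University Lecture Series 16, AMS (1999), §18 p. 79 (semisimple descent; the central case), §17 p. 77 (`|D_G| = |η_𝔤|`). Context locator.
* [Humphreys1972] J. E. Humphreys, *Introduction to Lie Algebras and Representation Theory*, GTM 9 (1972), §23.2 (the discriminant as a homogeneous
  `Ad`-invariant polynomial). Context locator for §1–§2.
* Mathlib `Mathlib/RingTheory/Polynomial/Resultant/Basic.lean` (`Polynomial.discr`, `resultant_deriv`, `resultant_scaleRoots`), `Mathlib/LinearAlgebra/Matrix/Charpoly/Disc.lean`.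
-/

set_option autoImplicit false
-- the mandated namespace repeats the single-problem summit's segment (`HodgeConjecture.HodgeConjecture`)
set_option linter.dupNamespace false

open Polynomial

namespace Summit.HodgeConjecture.HodgeConjecture.Cruxes.H413.K2E3UnitRelScalarMul

/-! ## §1 Root scaling: the substitution `X ↦ zX`, the derivative, and the discriminant of a monic -/

section Poly

variable {R : Type*} [CommRing R]

/-- `(p.scaleRoots s)(sX) = s^{deg p} · p(X)` over any commutative ring (Mathlib's `scaleRoots_eval₂_mul` with `f = C`, `r = X`; the field case is ★
`Literature.Algebra.Polynomial.scaleRoots_comp_C_mul_X`). [cite: Humphreys1972, §23.2] -/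
theorem scaleRoots_comp_C_mul_X (p : R[X]) (s : R) : (p.scaleRoots s).comp (C s * X) = C (s ^ p.natDegree) * p := by
  have h := scaleRoots_eval₂_mul (p := p) (C : R →+* R[X]) X s
  change (p.scaleRoots s).eval₂ C (C s * X) = _
  rw [h, C_pow, eval₂_C_X]

/-- The substitution `X ↦ zX` is injective on `R[X]` for a unit `z` (compose back with `X ↦ z⁻¹X`; the `IsUnit` form is ★
`Literature.NumberTheory.GaloisRepresentations.comp_C_mul_X_injective`). [cite: Humphreys1972, §23.2] -/
theorem comp_C_mul_X_injective_of_units (z : Rˣ) : Function.Injective fun q : R[X] => q.comp (C (z : R) * X) := by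
  intro q q' h
  have key : ∀ p : R[X], (p.comp (C (z : R) * X)).comp (C ((z⁻¹ : Rˣ) : R) * X) = p := fun p => by
    rw [comp_assoc, mul_comp, C_comp, X_comp, ← mul_assoc, ← C_mul, Units.mul_inv, C_1, one_mul, comp_X]
  have h' := congrArg (fun p : R[X] => p.comp (C ((z⁻¹ : Rˣ) : R) * X)) h
  simpa only [key] using h'

/-- **Derivative of a root-scaled polynomial**: `(f.scaleRoots r)′ = C r^{n−1−d} · (f′).scaleRoots r` with `n = natDegree f`, `d = natDegree f′`
(coefficientwise: both sides have `i`-th coefficient `(i+1) a_{i+1} r^{n−1−i}`; the factor `r^{n−1−d}` accounts for `natDegree f′ < n − 1` in positive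
characteristic). [cite: Humphreys1972, §23.2] -/
theorem derivative_scaleRoots (f : R[X]) (r : R) :
    derivative (f.scaleRoots r) = C (r ^ (f.natDegree - 1 - (derivative f).natDegree)) * (derivative f).scaleRoots r := by
  ext i
  simp only [coeff_derivative, coeff_scaleRoots, coeff_C_mul]
  by_cases hi : i ≤ (derivative f).natDegree
  · have hd : (derivative f).natDegree ≤ f.natDegree - 1 := natDegree_derivative_le f
    have hexp : f.natDegree - (i + 1) = (f.natDegree - 1 - (derivative f).natDegree) + ((derivative f).natDegree - i) := by
      omega
    rw [hexp, pow_add]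
    ring
  · have h0 : f.coeff (i + 1) * ((i : R) + 1) = 0 := by
      rw [← coeff_derivative]
      exact coeff_eq_zero_of_natDegree_lt (not_le.mp hi)
    calc f.coeff (i + 1) * r ^ (f.natDegree - (i + 1)) * ((i : R) + 1)
        = f.coeff (i + 1) * ((i : R) + 1) * r ^ (f.natDegree - (i + 1)) := by ring
      _ = (r ^ (f.natDegree - 1 - (derivative f).natDegree)) *
            (f.coeff (i + 1) * ((i : R) + 1) * r ^ ((derivative f).natDegree - i)) := by rw [h0]; ring

/-- **The discriminant of a monic polynomial is homogeneous of weight `n(n−1)` under root scaling**: `disc(f.scaleRoots r) = r^{n(n−1)} · disc f`,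
`n = deg f`, over ANY commutative ring (`disc = a_n^{2n−2} ∏_{i<j} (x_i − x_j)²` has `n(n−1)` root differences; proved here through Mathlib's Sylvester
resultant: `Res_{n,n−1}(f, f′) = ± lc f · disc f`, `Res(f∘r, g∘r) = r^{deg f·deg g} Res(f, g)`). [cite: Humphreys1972, §23.2] -/
theorem discr_scaleRoots_of_monic {f : R[X]} (hf : f.Monic) (r : R) :
    (f.scaleRoots r).discr = r ^ (f.natDegree * (f.natDegree - 1)) * f.discr := by
  rcases Nat.eq_zero_or_pos f.natDegree with hn0 | hnpos
  · -- degree `0`: `f = 1`, both discriminants are `1`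
    have hf1 : f = 1 := (Polynomial.Monic.natDegree_eq_zero hf).mp hn0
    subst hf1
    rw [one_scaleRoots, hn0, zero_mul, pow_zero, one_mul]
  · set n := f.natDegree with hn
    set d := (derivative f).natDegree with hd
    set k := n - 1 - d with hk
    have hdle : d ≤ n - 1 := natDegree_derivative_le f
    have hk' : n - 1 = d + k := by omega
    have hF : (f.scaleRoots r).Monic := (monic_scaleRoots_iff r).mpr hf
    have hdeg : 0 < f.degree := natDegree_pos_iff_degree_pos.mp hnpos
    have hdegF : 0 < (f.scaleRoots r).degree := by rw [degree_scaleRoots]; exact hdeg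
    -- `Res_{n,n-1}(F, F') = ε · disc F`, `Res_{n,n-1}(f, f') = ε · disc f` (`lc = 1`)
    have h1 := resultant_deriv hdegF
    have h2 := resultant_deriv hdeg
    rw [natDegree_scaleRoots, leadingCoeff_scaleRoots, hf.leadingCoeff, mul_one] at h1
    rw [hf.leadingCoeff, mul_one] at h2
    rw [← hn] at h1 h2
    -- the resultants scale by `r ^ (n (n-1))`
    have key : resultant (f.scaleRoots r) (derivative (f.scaleRoots r)) n (n - 1) =
        r ^ (n * (n - 1)) * resultant f (derivative f) n (n - 1) := by
      have hcoefF : (f.scaleRoots r).coeff n = 1 := by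
        have h := hF.coeff_natDegree
        rwa [natDegree_scaleRoots] at h
      have hcoef : f.coeff n = 1 := hf.coeff_natDegree
      have hs := resultant_scaleRoots f (derivative f) r
      rw [natDegree_scaleRoots, natDegree_scaleRoots, ← hn, ← hd] at hs
      rw [derivative_scaleRoots, ← hn, ← hd, ← hk, resultant_C_mul_right, hk',
        resultant_add_right_deg (f.scaleRoots r) ((derivative f).scaleRoots r) n d k (by rw [natDegree_scaleRoots]),
        resultant_add_right_deg f (derivative f) n d k le_rfl, hcoefF, hcoef,
        one_pow, one_mul, one_mul, hs, ← mul_assoc, ← pow_mul, ← pow_add]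
      congr 2
      ring
    -- cancel the sign `ε = (-1)^{n(n-1)/2}` (`ε² = 1`)
    have hε : ((-1 : R) ^ (n * (n - 1) / 2)) * ((-1 : R) ^ (n * (n - 1) / 2)) = 1 := by
      rw [← pow_add, ← two_mul, pow_mul, neg_one_sq, one_pow]
    have h3 : (-1 : R) ^ (n * (n - 1) / 2) * (f.scaleRoots r).discr =
        r ^ (n * (n - 1)) * ((-1 : R) ^ (n * (n - 1) / 2) * f.discr) := by
      rw [← h1, ← h2]
      exact key
    calc (f.scaleRoots r).discr
        = ((-1 : R) ^ (n * (n - 1) / 2) * (-1 : R) ^ (n * (n - 1) / 2)) * (f.scaleRoots r).discr := by rw [hε, one_mul]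
      _ = (-1 : R) ^ (n * (n - 1) / 2) * (r ^ (n * (n - 1)) * ((-1 : R) ^ (n * (n - 1) / 2) * f.discr)) := by
          rw [mul_assoc, h3]
      _ = r ^ (n * (n - 1)) * f.discr * ((-1 : R) ^ (n * (n - 1) / 2) * (-1 : R) ^ (n * (n - 1) / 2)) := by ring
      _ = r ^ (n * (n - 1)) * f.discr := by rw [hε, mul_one]

end Poly

/-! ## §2 The characteristic polynomial of a scalar unit multiple and its discriminant -/

section Charpoly

variable {R : Type*} [CommRing R] {n : Type*} [Fintype n] [DecidableEq n]

/-- **`χ_{zA} = χ_A.scaleRoots z` for a unit scalar `z`** over any commutative ring (the eigenvalues are multiplied by `z`): after the injective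
substitution `X ↦ zX` both sides become `z^N · χ_A` — `det(zX·1 − zA) = z^N det(X·1 − A)`.  (Field case, `z ≠ 0`: ★
`Literature.NumberTheory.GaloisRepresentations.charpoly_smul_of_ne_zero`.) [cite: Humphreys1972, §23.2] -/
theorem charpoly_units_smul (z : Rˣ) (A : Matrix n n R) : ((z : R) • A).charpoly = A.charpoly.scaleRoots (z : R) := by
  nontriviality R
  apply comp_C_mul_X_injective_of_units z
  dsimp only
  rw [scaleRoots_comp_C_mul_X, Matrix.charpoly_natDegree_eq_dim]
  have h1 : ((z : R) • A).charpoly.comp (C (z : R) * X) =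
      ((Polynomial.compRingHom (C (z : R) * X)).mapMatrix (Matrix.charmatrix ((z : R) • A))).det := by
    rw [Matrix.charpoly, ← RingHom.map_det]
    rfl
  have h2 : (Polynomial.compRingHom (C (z : R) * X)).mapMatrix (Matrix.charmatrix ((z : R) • A)) = C (z : R) • Matrix.charmatrix A := by
    ext i j : 2
    by_cases hij : i = j
    · subst hij
      simp [Matrix.charmatrix_apply_eq, mul_sub]
    · simp [Matrix.charmatrix_apply_ne _ _ _ hij, smul_eq_mul]
  rw [h1, h2, Matrix.det_smul, Matrix.charpoly, ← C_pow]

/-- **`disc(χ_{zA}) = z^{N(N−1)} · disc(χ_A)`** for a unit scalar `z`, `N = card n`, any commutative ring (★ `Literature.LinearAlgebra.Matrix.discr_smul_fin_three`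
is the case `N = 3`, any `z`). [cite: Humphreys1972, §23.2] -/
theorem discr_charpoly_units_smul (z : Rˣ) (A : Matrix n n R) :
    ((z : R) • A).charpoly.discr = (z : R) ^ (Fintype.card n * (Fintype.card n - 1)) * A.charpoly.discr := by
  nontriviality R
  rw [charpoly_units_smul, discr_scaleRoots_of_monic (Matrix.charpoly_monic A), Matrix.charpoly_natDegree_eq_dim]

/-- The same in Mathlib's `Matrix.discr` spelling: `Matrix.discr (z • A) = z^{N(N−1)} · Matrix.discr A`. [cite: Humphreys1972, §23.2] -/
theorem matrixDiscr_units_smul (z : Rˣ) (A : Matrix n n R) :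
    ((z : R) • A).discr = (z : R) ^ (Fintype.card n * (Fintype.card n - 1)) * A.discr := by
  rw [Matrix.discr, Matrix.discr, discr_charpoly_units_smul]

end Charpoly

/-! ## §3 The unit relation `u · det(g)^{N−1} = disc(χ_g)` is invariant under central (scalar unit) translation -/

section UnitRel

variable {R : Type*} [CommRing R]

/-- **Central reduction of the unit relation** (any finite index type, `N = card n`): for a unit scalar `z`, `u · det(zA)^{N−1} = disc(χ_{zA})` iff
`u · det(A)^{N−1} = disc(χ_A)` — both sides are multiplied by the unit `z^{N(N−1)}` (`det(zA) = z^N det A`, `disc(χ_{zA}) = z^{N(N−1)} disc(χ_A)`).  This is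
why Harish-Chandra's descent at a central point `ζ·s` is the descent at `s`. [cite: HarishChandra1999AdmissibleDistributions, §18 p. 79] -/
theorem unitRel_units_smul_iff {n : Type*} [Fintype n] [DecidableEq n] (z : Rˣ) (u : R) (A : Matrix n n R) :
    u * ((z : R) • A).det ^ (Fintype.card n - 1) = ((z : R) • A).charpoly.discr ↔
      u * A.det ^ (Fintype.card n - 1) = A.charpoly.discr := by
  rw [discr_charpoly_units_smul, Matrix.det_smul, mul_pow, ← pow_mul,
    show u * ((z : R) ^ (Fintype.card n * (Fintype.card n - 1)) * A.det ^ (Fintype.card n - 1)) =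
      (z : R) ^ (Fintype.card n * (Fintype.card n - 1)) * (u * A.det ^ (Fintype.card n - 1)) by ring]
  exact (z.isUnit.pow _).mul_right_inj

/-- **Central reduction of the unit relation, `Fin N` form** (the exponent `N − 1` and the carrier `Matrix (Fin N) (Fin N) R` exactly as in the U12 sockets):
`u · det(z • A)^{N−1} = disc(χ_{z•A}) ↔ u · det(A)^{N−1} = disc(χ_A)` for `z ∈ Rˣ`. [cite: HarishChandra1999AdmissibleDistributions, §18 p. 79] -/
theorem unitRel_units_smul_iff_fin {N : ℕ} (z : Rˣ) (u : R) (A : Matrix (Fin N) (Fin N) R) :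
    u * ((z : R) • A).det ^ (N - 1) = ((z : R) • A).charpoly.discr ↔ u * A.det ^ (N - 1) = A.charpoly.discr := by
  have h := unitRel_units_smul_iff z u A
  rwa [Fintype.card_fin] at h

end UnitRel

end Summit.HodgeConjecture.HodgeConjecture.Cruxes.H413.K2E3UnitRelScalarMul
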